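import Summits.ABC.StewartYu.PadicG3HalfValues
import Summits.ABC.StewartYu.TwistHalfPointAlgebra
import Summits.ABC.StewartYu.PadicMultiquadratic
import Summits.ABC.StewartYu.DescentSetupQ
import Mathlib.NumberTheory.Padics.Complex
import HarnessLib

/-!
# Cell abc-stewartyu, crux `Y07Odd` (stmt-ABC-19658), line `gen3-slab-odd`: the Kummer half-step, part 2 — the value `φ_τ(s/2)` READ IN
# `ℂ_p` and split along `ι` into the two signed parity class-sum vectors (provider-B / PM mechanism, generic family)

`Summits/ABC/StewartYu/PadicG3HalfSplit.lean` — sequel to `PadicG3HalfValues` (cell `abc-stewartyu`, design HOME/p2/HALFSTEP-ODD.md; seat p2-g4,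
F-odd lead).  Place-free monomial algebra for NATURAL exponent vectors `e : Fin n → ℕ` (`SsetG`, `qEhG`, `prod_root_pow_eq`,
`sum_prod_root_pow_eq_evL` — reusing `SetupQ.pow_eq_pow_div_two_mul`; generic forms of `SetupQ.prod_root_pow_expn`/`sum_prod_root_pow_eq_evL`), the root data
(`exists_root_data`: `ŝ_j := psqrt(ω_j)·ξ^{−r_j}` with `ŝ_j² = α_j`, `‖ŝ_j‖ ≤ 1`), and **`g3Φ_half_complex_split`**: for a family whose
root exponents at the half point are the natural vectors `e i` up to a common unit (`∏ sq_j^{vᵢⱼ s} = U · ∏ sq_j^{eᵢⱼ}`) and lie in one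
exponent class `Σ_j r_j eᵢⱼ = c₀ + kᵢ·M`,
`φ_τ(s/2) = U · ξ^{c₀} · (Σ₀ + ι·Σ₁)` in `ℂ_p`, `Σ_b = Σ_{kᵢ ≡ b (2)} (−1)^{⌊kᵢ/2⌋} pᵢ cᵢ ∏ ŝ_j^{eᵢⱼ} = evL ŝ (C_b)` with the RATIONAL class-sum
vectors `C_b T' = Σ_{i : kᵢ ≡ b, SsetG(eᵢ) = T'} (−1)^{⌊kᵢ/2⌋} pᵢ · cᵢ · qEhG α (eᵢ)` (`cᵢ = (Hasse_{t₀}Rᵢ)(s/2)·zγpow`).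

WHAT THIS IS NOT: no separation (part 3, `TwistHalf.norm_evL_add_iota_mul_ge`), no descent; no crux moves.

References: K. Yu, Compositio 74 (1990) (2.92)–(2.106); cell memo HOME/p3/memo-05 §3 (PM); Cijsouw–Waldschmidt 1977 §4 (p. 189).
-/

noncomputable section

open NormedSpace Finset Polynomial
open Literature.NumberTheory.Transcendental
open Literature.NumberTheory.Transcendental.CW77.Setup (Tau tauNorm)
open scoped Nat

namespace Summit.ABC.StewartYu

/-! ### Place-free: root monomials with natural exponents -/

namespace HalfMono

variable {L : Type*} [Field L] [CharZero L] {n : ℕ}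

/-- The parity set of an exponent vector: the generators with an odd exponent. [cite: CijsouwWaldschmidt1977, §4 (p. 189)] -/
def SsetG (e : Fin n → ℕ) : Finset (Fin n) := univ.filter fun j => e j % 2 = 1

/-- The rational part of a root monomial: `∏ⱼ αⱼ^{⌊eⱼ/2⌋}`. [cite: CijsouwWaldschmidt1977, §4 (p. 189)] -/
def qEhG (α : Fin n → ℚ) (e : Fin n → ℕ) : ℚ := ∏ j, α j ^ (e j / 2)

/-- `qEhG ≠ 0` for nonzero generators. [folklore] -/
theorem qEhG_ne (α : Fin n → ℚ) (hα : ∀ j, α j ≠ 0) (e : Fin n → ℕ) : qEhG α e ≠ 0 :=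
  prod_ne_zero_iff.mpr fun j _ => pow_ne_zero _ (hα j)

/-- **`∏ⱼ ŝⱼ^{eⱼ} = qEhG α e · ∏_{j ∈ SsetG e} ŝⱼ`** for square roots `ŝⱼ² = αⱼ`. [folklore] -/
theorem prod_root_pow_eq (α : Fin n → ℚ) (ŝ : Fin n → L) (hŝ : ∀ j, ŝ j * ŝ j = (α j : L)) (e : Fin n → ℕ) :
    ∏ j, ŝ j ^ e j = (qEhG α e : L) * Multiquad.monoL ŝ (SsetG e) := by
  unfold qEhG Multiquad.monoL SsetG
  rw [Rat.cast_prod, Finset.prod_filter, ← prod_mul_distrib]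
  refine prod_congr rfl fun j _ => ?_
  rw [SetupQ.pow_eq_pow_div_two_mul (ŝ j), hŝ j, Rat.cast_pow]

/-- **A sum of root monomials is the evaluation of its class sums**: for integer weights `w` and rational coefficients `c`,
`Σ_{i∈U} wᵢ cᵢ ∏ⱼ ŝⱼ^{eᵢⱼ} = evL ŝ (T' ↦ Σ_{i∈U, SsetG(eᵢ) = T'} wᵢ·(cᵢ·qEhG α eᵢ))`. [folklore] -/
theorem sum_prod_root_pow_eq_evL {υ : Type*} (α : Fin n → ℚ) (ŝ : Fin n → L) (hŝ : ∀ j, ŝ j * ŝ j = (α j : L))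
    (U : Finset υ) (w : υ → ℤ) (c : υ → ℚ) (e : υ → Fin n → ℕ) :
    ∑ i ∈ U, (w i : L) * (c i : L) * ∏ j, ŝ j ^ e i j =
      Multiquad.evL ŝ (fun T' => ∑ i ∈ U with SsetG (e i) = T', (w i : ℚ) * (c i * qEhG α (e i))) := by
  classical
  unfold Multiquad.evL
  have hfib : ∑ i ∈ U, (w i : L) * (c i : L) * ∏ j, ŝ j ^ e i j =
      ∑ i ∈ U, (((w i : ℚ) * (c i * qEhG α (e i)) : ℚ) : L) * Multiquad.monoL ŝ (SsetG (e i)) := by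
    refine sum_congr rfl fun i _ => ?_
    rw [prod_root_pow_eq α ŝ hŝ]; push_cast; ring
  rw [hfib, ← Finset.sum_fiberwise U (fun i => SsetG (e i))
    (fun i => ((((w i : ℚ) * (c i * qEhG α (e i)) : ℚ) : L) * Multiquad.monoL ŝ (SsetG (e i))))]
  refine sum_congr rfl fun T' _ => ?_
  rw [Rat.cast_sum, sum_mul]
  refine sum_congr rfl fun i hi => ?_
  rw [(Finset.mem_filter.mp hi).2]

end HalfMono

namespace G3Setup

variable {p : ℕ} [Fact p.Prime] (S : G3Setup p) {ι : Type*} (R : ι → ℚ[X]) (v : ι → Fin S.n → ℤ)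

/-! ### The root data in `ℂ_p` -/

/-- **The root data.** If `η_j = ζ^{r_j}` and `ξ² = ζ` in `ℂ_p` with `‖ξ‖ = 1`, then `ŝ_j := psqrt(ω_j)·(ξ^{r_j})⁻¹` satisfies
`ŝ_j·ξ^{r_j} = sq_j`, `ŝ_j² = α_j`, `‖ŝ_j‖ ≤ 1`. [cite: Yu1990, (2.101)–(2.106); shape only] -/
theorem exists_root_data {ζ : ℚ_[p]} (r : Fin S.n → ℕ) (hη : ∀ j, S.η j = ζ ^ r j)
    {ξ : ℂ_[p]} (hξ2 : ξ ^ 2 = algebraMap ℚ_[p] ℂ_[p] ζ) (hξ : ‖ξ‖ = 1) :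
    ∃ ŝ : Fin S.n → ℂ_[p],
      (∀ j, algebraMap ℚ_[p] ℂ_[p] (S.sq j) = ŝ j * ξ ^ r j) ∧
      (∀ j, ŝ j * ŝ j = (S.α j : ℂ_[p])) ∧ (∀ j, ‖ŝ j‖ ≤ 1) := by
  have hξ0 : ξ ≠ 0 := fun h0 => by rw [h0, norm_zero] at hξ; exact zero_ne_one hξ
  have hξr : ∀ j, ξ ^ r j ≠ 0 := fun j => pow_ne_zero _ hξ0
  refine ⟨fun j => algebraMap ℚ_[p] ℂ_[p] (S.sq j) * (ξ ^ r j)⁻¹, ?_, ?_, ?_⟩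
  · intro j; rw [mul_assoc, inv_mul_cancel₀ (hξr j), mul_one]
  · intro j
    have hsq : S.sq j * S.sq j = S.ω j := by rw [← pow_two, S.sq_sq]
    have hω : algebraMap ℚ_[p] ℂ_[p] (S.ω j) = (S.α j : ℂ_[p]) * (ξ ^ r j) ^ 2 := by
      unfold ω
      rw [map_mul, hη j, map_pow, ← hξ2, map_ratCast, ← pow_mul, ← pow_mul, mul_comm 2]
    calc algebraMap ℚ_[p] ℂ_[p] (S.sq j) * (ξ ^ r j)⁻¹ * (algebraMap ℚ_[p] ℂ_[p] (S.sq j) * (ξ ^ r j)⁻¹)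
        = algebraMap ℚ_[p] ℂ_[p] (S.sq j * S.sq j) * ((ξ ^ r j)⁻¹) ^ 2 := by rw [map_mul]; ring
      _ = (S.α j : ℂ_[p]) := by
          rw [hsq, hω, inv_pow, mul_assoc, mul_inv_cancel₀ (pow_ne_zero _ (hξr j)), mul_one]
  · intro j
    rw [norm_mul, norm_inv, norm_pow, hξ, one_pow, inv_one, mul_one,
      show algebraMap ℚ_[p] ℂ_[p] (S.sq j) = ((S.sq j : ℚ_[p]) : ℂ_[p]) from rfl, PadicComplex.norm_extends', S.norm_sq j]

/-! ### The split along `ι` -/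

/-- **`φ_τ(s/2)` in `ℂ_p`, split along `ι`.**  Let the root monomials of the family at `s/2` be a common unit `U` times natural-exponent
monomials, `∏ⱼ sq_j^{vᵢⱼ s} = U · ∏ⱼ sq_j^{eᵢⱼ}` on `B`, lying in one exponent class `Σⱼ r_j eᵢⱼ = c₀ + kᵢ·M`; then with the root data
`sq_j = ŝ_j ξ^{r_j}`, `ξ^M = ι`, `ι² = −1`:
`φ_τ(s/2) = U·ξ^{c₀}·(Σ₀ + ι·Σ₁)`, `Σ_b = Σ_{i∈B, kᵢ ≡ b} (−1)^{⌊kᵢ/2⌋}·pᵢ·cᵢ·∏ ŝ_j^{eᵢⱼ}`, `cᵢ = (Hasse_{t₀}Rᵢ)(s/2)·zγpow`.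
[cite: Yu1990, (2.94)–(2.100); shape only] -/
theorem g3Φ_half_complex_split (B : Finset ι) (pv : ι → ℤ) (τ : Tau S.n) (s : ℤ) (U : ℚ_[p]) (e : ι → Fin S.n → ℕ)
    (he : ∀ i ∈ B, ∏ j, S.sq j ^ (v i j * s) = U * ∏ j, S.sq j ^ e i j)
    (ŝ : Fin S.n → ℂ_[p]) (ξ ιC : ℂ_[p]) (r : Fin S.n → ℕ) {M c₀ : ℕ} (k : ι → ℕ)
    (hσ : ∀ j, algebraMap ℚ_[p] ℂ_[p] (S.sq j) = ŝ j * ξ ^ r j)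
    (hι : ξ ^ M = ιC) (hι2 : ιC ^ 2 = -1)
    (hcls : ∀ i ∈ B, ∑ j, r j * e i j = c₀ + k i * M) :
    algebraMap ℚ_[p] ℂ_[p] (S.g3Φ R v B pv τ ((2 : ℚ_[p])⁻¹ * (s : ℚ_[p]))) =
      algebraMap ℚ_[p] ℂ_[p] U * (ξ ^ c₀ *
        ((∑ i ∈ B.filter (fun i => Even (k i)),
            ((-1) ^ (k i / 2) * ((pv i : ℂ_[p]) *
              (((hasseDeriv τ.1 (R i)).eval ((s : ℚ) / 2) * S.zγpow v i τ.2 : ℚ) : ℂ_[p]))) * ∏ j, ŝ j ^ e i j) +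
          ιC * ∑ i ∈ B.filter (fun i => ¬ Even (k i)),
            ((-1) ^ (k i / 2) * ((pv i : ℂ_[p]) *
              (((hasseDeriv τ.1 (R i)).eval ((s : ℚ) / 2) * S.zγpow v i τ.2 : ℚ) : ℂ_[p]))) * ∏ j, ŝ j ^ e i j)) := by
  classical
  rw [S.g3Φ_half R v B pv τ s]
  -- pull the common unit `U` out and move the roots to `ℂ_p`
  have hterm : ∀ i ∈ B, algebraMap ℚ_[p] ℂ_[p]
      ((((pv i : ℚ) * ((hasseDeriv τ.1 (R i)).eval ((s : ℚ) / 2) * S.zγpow v i τ.2) : ℚ) : ℚ_[p]) * ∏ j, S.sq j ^ (v i j * s)) =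
      algebraMap ℚ_[p] ℂ_[p] U * (((pv i : ℂ_[p]) *
        (((hasseDeriv τ.1 (R i)).eval ((s : ℚ) / 2) * S.zγpow v i τ.2 : ℚ) : ℂ_[p])) * ∏ j, (ŝ j * ξ ^ r j) ^ e i j) := by
    intro i hi
    rw [he i hi, Rat.cast_mul, Rat.cast_intCast, map_mul, map_mul, map_mul, map_prod, map_intCast, map_ratCast]
    have : ∀ j, algebraMap ℚ_[p] ℂ_[p] (S.sq j ^ e i j) = (ŝ j * ξ ^ r j) ^ e i j := fun j => by rw [map_pow, hσ j]
    simp_rw [this]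
    ring
  rw [map_sum, sum_congr rfl hterm, ← mul_sum,
    TwistHalf.sum_prod_twist_eq B _ e ŝ ξ ιC r k hι hι2 hcls]

/-- **The two halves are evaluations of the signed class-sum vectors** on the algebraic roots `ŝ_j` (`ŝ_j² = α_j`):
`Σ_b = evL ŝ (T' ↦ Σ_{i ∈ B_b, SsetG(eᵢ) = T'} (−1)^{⌊kᵢ/2⌋} pᵢ · (cᵢ · qEhG α eᵢ))`. [folklore] -/
theorem half_sum_eq_evL (B' : Finset ι) (pv : ι → ℤ) (τ : Tau S.n) (s : ℤ) (e : ι → Fin S.n → ℕ)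
    (ŝ : Fin S.n → ℂ_[p]) (hŝ : ∀ j, ŝ j * ŝ j = (S.α j : ℂ_[p])) (k : ι → ℕ) :
    ∑ i ∈ B', ((-1) ^ (k i / 2) * ((pv i : ℂ_[p]) *
        (((hasseDeriv τ.1 (R i)).eval ((s : ℚ) / 2) * S.zγpow v i τ.2 : ℚ) : ℂ_[p]))) * ∏ j, ŝ j ^ e i j =
      Multiquad.evL ŝ (fun T' => ∑ i ∈ B' with HalfMono.SsetG (e i) = T',
        (((-1) ^ (k i / 2) * pv i : ℤ) : ℚ) *
          (((hasseDeriv τ.1 (R i)).eval ((s : ℚ) / 2) * S.zγpow v i τ.2) * HalfMono.qEhG S.α (e i))) := by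
  rw [← HalfMono.sum_prod_root_pow_eq_evL S.α ŝ hŝ B' (fun i => (-1) ^ (k i / 2) * pv i)
    (fun i => (hasseDeriv τ.1 (R i)).eval ((s : ℚ) / 2) * S.zγpow v i τ.2) e]
  refine sum_congr rfl fun i _ => ?_
  push_cast
  ring

end G3Setup

end Summit.ABC.StewartYu

end
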